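import Summits.ResolutionOfSingularities.ResolutionOfSingularities.Theorems.FrobeniusClosingSteerToricVertexSplit
import HarnessLib

/-!
# Crux `Steer` (stmt-ResolutionOfSingularities-16345) — TORIC EXIT AT A DOMINANT VERTEX, part 2: PERRON MONOMIALISATION of finitely
# many Laurent monomials of positive value along ANY valuation ring (the exponent game)

OURS (campaign res-hironaka, rung L ★L-G4, slot W4.1; res-D-brk-2 g6 on res-L0-w41-plan-1 RULING 229 (d), E-ROW #3; signature file
`D/res-D-brk-2/K_W9_signature.lean` 40590a5e08b7c948). Candidates, not facts; NOT a statement of H. Hironaka's manuscript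
[claim: Hironaka2017, status: under-review]; AI formalisation, weaker than expert review; `--supports stmt-ResolutionOfSingularities-16345`,
counted 0. Definition-free (uses part 1's `Relettering`).

## What is proved (any fields `k ⊆ K`, any valuation subring `O` of `K`, letters `z : Fin n → K` in `O ∖ 0`)

* `exists_relettering_uniform` — for every exponent vector `e : Fin n → ℤ` there is an admissible re-lettering (part 1) after which the
  transformed vector `T e` is `≥ 0` or `≤ 0` coordinatewise;
* `exists_relettering_nonneg` — hence a Laurent monomial `z ^ e` of value `< 1` (i.e. in `𝔪_O`) becomes an `ℕ`-MONOMIAL in the new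
  letters (the `≤ 0` alternative would put `(z^e)⁻¹` in `O`);
* `exists_relettering_nonneg_family` — finitely many such monomials at once (`ℕ`-vectors stay `ℕ`-vectors under later blow-ups).

TERMINATION (the valuation only chooses the branch of each pair blow-up; Lean never enumerates the tree): strategy «blow up a letter
of maximal `|e_j|` against a letter of the opposite sign» with the potential lex(`M` = max `|e_j|`, `c` = #{`j` : `|e_j| = M`},
`m` = #{letters of sign opposite to the `M`-letters}), as three nested strong inductions (`§3` bookkeeping, `§4` the induction; the
negative orientation is reduced to the positive one through `T (-e) = -T e`). [cite: Teissier2014] [folklore]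
-/

noncomputable section

-- single-problem summit: the doubled namespace component `ResolutionOfSingularities` is forced
set_option linter.dupNamespace false

open scoped BigOperators

namespace Summit.ResolutionOfSingularities.ResolutionOfSingularities.Theorems.SteerToricVertexSplit

variable {k K : Type} [Field k] [Field K] [Algebra k K]

/-! ## §3 The exponent game: potential lex(`M`, `c`, `m`) -/

section Game

variable {n : ℕ}

/-- `M e = max_j |e_j|` (as a natural number; `0` for `n = 0`). -/
private def M (e : Fin n → ℤ) : ℕ := Finset.univ.sup fun j => (e j).natAbs

/-- `c e` = number of letters with `|e_j| = M e`. -/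
private def cnt (e : Fin n → ℤ) : ℕ := (Finset.univ.filter fun j => (e j).natAbs = M e).card

/-- number of negative letters. -/
private def negs (e : Fin n → ℤ) : ℕ := (Finset.univ.filter fun j => e j < 0).card

/-- Every letter is bounded by the maximum. -/
private theorem natAbs_le_M (e : Fin n → ℤ) (j : Fin n) : (e j).natAbs ≤ M e := Finset.le_sup (f := fun j => (e j).natAbs) (by simp)

/-- Characterisation of upper bounds of the maximum. -/
private theorem M_le_iff (e : Fin n → ℤ) (N : ℕ) : M e ≤ N ↔ ∀ j, (e j).natAbs ≤ N := by simp [M, Finset.sup_le_iff]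

/-- If some letter is non-zero, the maximum `M e` is attained. -/
private theorem exists_natAbs_eq_M (e : Fin n → ℤ) (j₀ : Fin n) : ∃ j, (e j).natAbs = M e := by
  classical
  obtain ⟨j, -, hj⟩ := Finset.exists_mem_eq_sup (Finset.univ : Finset (Fin n)) ⟨j₀, Finset.mem_univ _⟩ fun j => (e j).natAbs
  exact ⟨j, hj.symm⟩

/-- A non-zero vector has positive maximum. -/
private theorem M_pos (e : Fin n → ℤ) {j₀ : Fin n} (hj₀ : e j₀ ≠ 0) : 0 < M e := (Int.natAbs_pos.mpr hj₀).trans_le (natAbs_le_M e j₀)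

/-- **Key potential lemma.** Replacing ONE letter `a` with `|e_a| = M e` by a value `w` with `|w| < M e` makes the pair (`M`, `c`) drop
lexicographically. [folklore] -/
private theorem lex_lt_of_update_max (e : Fin n → ℤ) (a : Fin n) (ha : (e a).natAbs = M e) (w : ℤ) (hw : w.natAbs < M e) :
    M (Function.update e a w) < M e ∨ (M (Function.update e a w) = M e ∧ cnt (Function.update e a w) < cnt e) := by
  classical
  set e' := Function.update e a w with he'
  have hle : M e' ≤ M e := by
    rw [M_le_iff]
    intro j
    by_cases h : j = a
    · subst h; rw [he', Function.update_self]; exact hw.le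
    · rw [he', Function.update_of_ne h]; exact natAbs_le_M e j
  rcases hle.lt_or_eq with hlt | heq
  · exact Or.inl hlt
  · right
    refine ⟨heq, ?_⟩
    -- the `M`-letters of `e'` are `M`-letters of `e` other than `a`
    have hsub : (Finset.univ.filter fun j => (e' j).natAbs = M e') ⊆ (Finset.univ.filter fun j => (e j).natAbs = M e).erase a := by
      intro j hj
      simp only [Finset.mem_filter, Finset.mem_univ, true_and] at hj
      rw [Finset.mem_erase, Finset.mem_filter]
      have hja : j ≠ a := by
        rintro rfl
        rw [he', Function.update_self, heq] at hj
        exact absurd hj hw.ne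
      refine ⟨hja, Finset.mem_univ _, ?_⟩
      rw [he', Function.update_of_ne hja, heq] at hj
      exact hj
    calc cnt e' ≤ ((Finset.univ.filter fun j => (e j).natAbs = M e).erase a).card := Finset.card_le_card hsub
      _ < cnt e := by rw [cnt]; exact Finset.card_erase_lt_of_mem (by simp [ha])

/-- Replacing a letter `b` that is NOT an `M`-letter by a non-`M` value leaves `M` and `c` unchanged, provided some other `M`-letter
exists. [folklore] -/
private theorem M_cnt_update_of_ne_max (e : Fin n → ℤ) (b : Fin n) (hb : (e b).natAbs < M e) (w : ℤ) (hw : w.natAbs < M e) :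
    M (Function.update e b w) = M e ∧ cnt (Function.update e b w) = cnt e := by
  classical
  set e' := Function.update e b w with he'
  have hle : M e' ≤ M e := by
    rw [M_le_iff]
    intro j
    by_cases h : j = b
    · subst h; rw [he', Function.update_self]; exact hw.le
    · rw [he', Function.update_of_ne h]; exact natAbs_le_M e j
  -- an `M`-letter of `e` exists and differs from `b`
  obtain ⟨j₁, hj₁⟩ := exists_natAbs_eq_M e b
  have hj₁b : j₁ ≠ b := by rintro rfl; exact absurd hj₁ hb.ne
  have hge : M e ≤ M e' := by
    rw [← hj₁]
    have : (e' j₁).natAbs = (e j₁).natAbs := by rw [he', Function.update_of_ne hj₁b]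
    rw [← this]
    exact natAbs_le_M e' j₁
  have heq : M e' = M e := le_antisymm hle hge
  refine ⟨heq, ?_⟩
  rw [cnt, cnt, heq]
  congr 1
  ext j
  simp only [Finset.mem_filter, Finset.mem_univ, true_and]
  by_cases h : j = b
  · subst h
    rw [he', Function.update_self]
    constructor
    · intro h1; exact absurd h1 hw.ne
    · intro h1; exact absurd h1 hb.ne
  · rw [he', Function.update_of_ne h]

/-- Counting: turning a negative letter non-negative lowers `negs` by one. [folklore] -/
private theorem negs_update_lt (e : Fin n → ℤ) (b : Fin n) (hb : e b < 0) (w : ℤ) (hw : 0 ≤ w) :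
    negs (Function.update e b w) < negs e := by
  classical
  rw [negs, negs]
  have hsub : (Finset.univ.filter fun j => Function.update e b w j < 0) ⊆ (Finset.univ.filter fun j => e j < 0).erase b := by
    intro j hj
    simp only [Finset.mem_filter, Finset.mem_univ, true_and] at hj
    have hjb : j ≠ b := by rintro rfl; rw [Function.update_self] at hj; exact absurd hj (not_lt.mpr hw)
    rw [Function.update_of_ne hjb] at hj
    simp [hjb, hj]
  calc _ ≤ ((Finset.univ.filter fun j => e j < 0).erase b).card := Finset.card_le_card hsub
    _ < _ := Finset.card_erase_lt_of_mem (by simp [hb])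

end Game

/-! ## §4 Perron monomialisation along a valuation ring -/

section Perron

variable {n : ℕ}

/-- Uniform sign of an exponent vector. -/
private def Uniform (e : Fin n → ℤ) : Prop := (∀ j, 0 ≤ e j) ∨ (∀ j, e j ≤ 0)

/-- Uniformity is invariant under negation. -/
private theorem uniform_neg_iff (e : Fin n → ℤ) : Uniform (-e) ↔ Uniform e := by
  constructor
  · rintro (h | h)
    · exact Or.inr fun j => by have := h j; simp at this; linarith
    · exact Or.inl fun j => by have := h j; simp at this; linarith
  · rintro (h | h)
    · exact Or.inr fun j => by simp; exact h j
    · exact Or.inl fun j => by simp; linarith [h j]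

/-- The core of the game, positive orientation: there is a POSITIVE letter of maximal absolute value. Induction on
lex(`M`, `c`, `negs`). OURS. [folklore] -/
private theorem perron_pos (O : ValuationSubring K) :
    ∀ (Mv cv mv : ℕ) (z : Fin n → K) (_ : ∀ j, z j ∈ O) (_ : ∀ j, z j ≠ 0) (e : Fin n → ℤ),
      M e = Mv → cnt e = cv → negs e = mv → (∃ a, 0 < e a ∧ (e a).natAbs = M e) →
      ∃ z' T, Relettering k O z z' T ∧ Uniform (T e) := by
  intro Mv
  induction Mv using Nat.strong_induction_on with
  | _ Mv ihM =>
  intro cv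
  induction cv using Nat.strong_induction_on with
  | _ cv ihc =>
  intro mv
  induction mv using Nat.strong_induction_on with
  | _ mv ihm =>
  intro z hzO hz0 e hMe hce hme hpos
  classical
  obtain ⟨a, ha0, haM⟩ := hpos
  -- if no negative letter, `e` is uniform already
  by_cases hneg : ∀ j, 0 ≤ e j
  · exact ⟨z, id, relettering_refl O z hzO hz0, Or.inl hneg⟩
  push Not at hneg
  obtain ⟨b, hb⟩ := hneg
  have hab : a ≠ b := by rintro rfl; exact absurd ha0 (not_lt.mpr hb.le)
  have heaM : e a = (M e : ℤ) := by
    rw [← haM, Int.natCast_natAbs]; exact (abs_of_pos ha0).symm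
  -- generic facts about the two possible new values
  have hwabs : (e a + e b).natAbs < M e := by
    have hMpos : (0 : ℤ) < M e := by rw [← heaM]; exact ha0
    have hb1 : -((e b).natAbs : ℤ) ≤ e b := by rw [Int.natCast_natAbs]; exact neg_abs_le (e b)
    have hb2 : ((e b).natAbs : ℤ) ≤ M e := by exact_mod_cast natAbs_le_M e b
    have h1 : e a + e b < M e := by rw [← heaM]; linarith
    have h2 : -(M e : ℤ) < e a + e b := by rw [heaM] at ha0 ⊢; linarith
    have h3 : ((e a + e b).natAbs : ℤ) < M e := by
      rw [Int.natCast_natAbs]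
      exact abs_lt.mpr ⟨h2, h1⟩
    exact_mod_cast h3
  -- blow up the pair (a, b) in the orientation chosen by `O`
  rcases relettering_step (k := k) O z hzO hz0 hab with ⟨z', hR⟩ | ⟨z', hR⟩
  · -- pivot `a`: the `M`-letter `a` is replaced by `e a + e b`, of absolute value `< M e` ⇒ (M, c) drops
    set e' : Fin n → ℤ := Function.update e a (e a + e b) with he'
    have hlex := lex_lt_of_update_max e a haM (e a + e b) hwabs
    -- orientation of `e'`: either uniform, or recurse
    by_cases hunif : Uniform e'
    · exact ⟨z', _, hR, hunif⟩
    · -- `e'` is not uniform; find a relettering for `e'` by the outer inductions, in the right orientation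
      have hrec : ∃ z'' T', Relettering k O z' z'' T' ∧ Uniform (T' e') := by
        -- decide orientation of e'
        have hne : ∃ j, e' j ≠ 0 := by
          by_contra hcon
          push Not at hcon
          exact hunif (Or.inl fun j => (hcon j).symm.le)
        obtain ⟨j₀, hj₀⟩ := hne
        by_cases hor : ∃ a', 0 < e' a' ∧ (e' a').natAbs = M e'
        · rcases hlex with hlt | ⟨hMeq, hclt⟩
          · exact ihM (M e') (hMe ▸ hlt) (cnt e') (negs e') z' hR.1 hR.2.1 e' rfl rfl rfl hor
          · exact ihc (cnt e') (hce ▸ hclt) (negs e') z' hR.1 hR.2.1 e' (hMeq.trans hMe) rfl rfl hor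
        · -- all `M`-letters of `e'` are non-positive: pass to `-e'`
          have hor' : ∃ a', 0 < (-e') a' ∧ ((-e') a').natAbs = M (-e') := by
            obtain ⟨j, hj⟩ := exists_natAbs_eq_M e' j₀
            have hMneg : M (-e') = M e' := by simp [M]
            have hjle : e' j ≤ 0 := by
              by_contra hcon
              push Not at hcon
              exact hor ⟨j, hcon, hj⟩
            have hjne : e' j ≠ 0 := by
              intro h0; rw [h0] at hj; simp at hj; exact absurd hj.symm (M_pos e' hj₀).ne'
            refine ⟨j, ?_, ?_⟩
            · simp; exact lt_of_le_of_ne hjle hjne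
            · simp [hMneg, hj]
          have hMneg : M (-e') = M e' := by simp [M]
          have hcneg : cnt (-e') = cnt e' := by simp [cnt, M]
          rcases hlex with hlt | ⟨hMeq, hclt⟩
          · obtain ⟨z'', T', hR', hU⟩ :=
              ihM (M (-e')) (by rw [hMneg, ← hMe]; exact hlt) (cnt (-e')) (negs (-e')) z' hR.1 hR.2.1 (-e') rfl rfl rfl hor'
            refine ⟨z'', T', hR', ?_⟩
            rw [hR'.2.2.2.2.1] at hU
            exact (uniform_neg_iff _).mp hU
          · obtain ⟨z'', T', hR', hU⟩ :=
              ihc (cnt (-e')) (by rw [hcneg, ← hce]; exact hclt) (negs (-e')) z' hR.1 hR.2.1 (-e')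
                (by rw [hMneg, hMeq, hMe]) rfl rfl hor'
            refine ⟨z'', T', hR', ?_⟩
            rw [hR'.2.2.2.2.1] at hU
            exact (uniform_neg_iff _).mp hU
      obtain ⟨z'', T', hR', hU⟩ := hrec
      exact ⟨z'', _, relettering_trans O hR hR', hU⟩
  · -- pivot `b`: the negative letter `b` is replaced by `e b + e a = e a + e b`
    set e' : Fin n → ℤ := Function.update e b (e b + e a) with he'
    by_cases hunif : Uniform e'
    · exact ⟨z', _, hR, hunif⟩
    · have hrec : ∃ z'' T', Relettering k O z' z'' T' ∧ Uniform (T' e') := by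
        by_cases hbM : (e b).natAbs = M e
        · -- `b` was an `M`-letter too: (M, c) drops
          have hwabs' : (e b + e a).natAbs < M e := by rw [add_comm]; exact hwabs
          have hlex := lex_lt_of_update_max e b hbM (e b + e a) hwabs'
          have hne : ∃ j, e' j ≠ 0 := by
            by_contra hcon; push Not at hcon
            exact hunif (Or.inl fun j => (hcon j).symm.le)
          obtain ⟨j₀, hj₀⟩ := hne
          by_cases hor : ∃ a', 0 < e' a' ∧ (e' a').natAbs = M e'
          · rcases hlex with hlt | ⟨hMeq, hclt⟩
            · exact ihM (M e') (hMe ▸ hlt) (cnt e') (negs e') z' hR.1 hR.2.1 e' rfl rfl rfl hor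
            · exact ihc (cnt e') (hce ▸ hclt) (negs e') z' hR.1 hR.2.1 e' (hMeq.trans hMe) rfl rfl hor
          · have hMneg : M (-e') = M e' := by simp [M]
            have hcneg : cnt (-e') = cnt e' := by simp [cnt, M]
            have hor' : ∃ a', 0 < (-e') a' ∧ ((-e') a').natAbs = M (-e') := by
              obtain ⟨j, hj⟩ := exists_natAbs_eq_M e' j₀
              have hjle : e' j ≤ 0 := by
                by_contra hcon; push Not at hcon; exact hor ⟨j, hcon, hj⟩
              have hjne : e' j ≠ 0 := by
                intro h0; rw [h0] at hj; simp at hj; exact absurd hj.symm (M_pos e' hj₀).ne'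
              exact ⟨j, by simp; exact lt_of_le_of_ne hjle hjne, by simp [hMneg, hj]⟩
            rcases hlex with hlt | ⟨hMeq, hclt⟩
            · obtain ⟨z'', T', hR', hU⟩ :=
                ihM (M (-e')) (by rw [hMneg, ← hMe]; exact hlt) (cnt (-e')) (negs (-e')) z' hR.1 hR.2.1 (-e') rfl rfl rfl hor'
              exact ⟨z'', T', hR', by rw [hR'.2.2.2.2.1] at hU; exact (uniform_neg_iff _).mp hU⟩
            · obtain ⟨z'', T', hR', hU⟩ :=
                ihc (cnt (-e')) (by rw [hcneg, ← hce]; exact hclt) (negs (-e')) z' hR.1 hR.2.1 (-e')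
                  (by rw [hMneg, hMeq, hMe]) rfl rfl hor'
              exact ⟨z'', T', hR', by rw [hR'.2.2.2.2.1] at hU; exact (uniform_neg_iff _).mp hU⟩
        · -- `b` was not an `M`-letter: (M, c) unchanged, `a` still a positive `M`-letter, `negs` drops
          have hbM' : (e b).natAbs < M e := lt_of_le_of_ne (natAbs_le_M e b) hbM
          have hwabs' : (e b + e a).natAbs < M e := by rw [add_comm]; exact hwabs
          obtain ⟨hMeq, hceq⟩ := M_cnt_update_of_ne_max e b hbM' (e b + e a) hwabs'
          have hw0 : 0 ≤ e b + e a := by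
            -- `e a = M e > |e b|`
            have h3 : ((e b).natAbs : ℤ) < M e := by exact_mod_cast hbM'
            have hb1 : -((e b).natAbs : ℤ) ≤ e b := by rw [Int.natCast_natAbs]; exact neg_abs_le (e b)
            rw [heaM]
            linarith
          have hnlt := negs_update_lt e b hb (e b + e a) hw0
          have hor : ∃ a', 0 < e' a' ∧ (e' a').natAbs = M e' := by
            refine ⟨a, ?_, ?_⟩
            · rw [he', Function.update_of_ne hab]; exact ha0
            · rw [he', Function.update_of_ne hab, hMeq]; exact haM
          exact ihm (negs e') (hme ▸ hnlt) z' hR.1 hR.2.1 e' (hMeq.trans hMe) (hceq.trans hce) rfl hor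
      obtain ⟨z'', T', hR', hU⟩ := hrec
      exact ⟨z'', _, relettering_trans O hR hR', hU⟩

/-- **Perron monomialisation of one Laurent monomial, exponent-game form**: along any valuation ring there is an admissible
re-lettering after which the exponent vector has a uniform sign. OURS. [folklore] -/
theorem exists_relettering_uniform (O : ValuationSubring K) (z : Fin n → K) (hzO : ∀ j, z j ∈ O) (hz0 : ∀ j, z j ≠ 0)
    (e : Fin n → ℤ) :
    ∃ (z' : Fin n → K) (T : (Fin n → ℤ) → (Fin n → ℤ)),
      ((∀ j, z' j ∈ O) ∧ (∀ j, z' j ≠ 0) ∧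
        IntermediateField.adjoin k (Set.range z') = IntermediateField.adjoin k (Set.range z) ∧
        (∀ f, (∏ j, z' j ^ T f j) = ∏ j, z j ^ f j) ∧ (∀ f, T (-f) = -T f) ∧
        (∀ f : Fin n → ℤ, (∀ j, 0 ≤ f j) → ∀ j, 0 ≤ T f j) ∧ (∀ f : Fin n → ℤ, (∃ j, Odd (f j)) → ∃ j, Odd (T f j))) ∧
      ((∀ j, 0 ≤ T e j) ∨ (∀ j, T e j ≤ 0)) := by
  classical
  by_cases hunif : Uniform e
  · exact ⟨z, id, relettering_refl O z hzO hz0, hunif⟩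
  have hne : ∃ j, e j ≠ 0 := by
    by_contra hcon; push Not at hcon
    exact hunif (Or.inl fun j => (hcon j).symm.le)
  obtain ⟨j₀, hj₀⟩ := hne
  by_cases hor : ∃ a, 0 < e a ∧ (e a).natAbs = M e
  · exact perron_pos O _ _ _ z hzO hz0 e rfl rfl rfl hor
  · have hMneg : M (-e) = M e := by simp [M]
    have hor' : ∃ a, 0 < (-e) a ∧ ((-e) a).natAbs = M (-e) := by
      obtain ⟨j, hj⟩ := exists_natAbs_eq_M e j₀
      have hjle : e j ≤ 0 := by
        by_contra hcon; push Not at hcon; exact hor ⟨j, hcon, hj⟩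
      have hjne : e j ≠ 0 := by
        intro h0; rw [h0] at hj; simp at hj; exact absurd hj.symm (M_pos e hj₀).ne'
      exact ⟨j, by simp; exact lt_of_le_of_ne hjle hjne, by simp [hMneg, hj]⟩
    obtain ⟨z', T, hR, hU⟩ := perron_pos (k := k) O _ _ _ z hzO hz0 (-e) rfl rfl rfl hor'
    refine ⟨z', T, hR, ?_⟩
    rw [hR.2.2.2.2.1] at hU
    exact (uniform_neg_iff _).mp hU

/-- **Perron monomialisation of a Laurent monomial of positive value**: if `z ^ e ∈ 𝔪_O` (value `< 1`), then after an admissible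
re-lettering it is an `ℕ`-monomial in the new letters. OURS. [folklore] -/
theorem exists_relettering_nonneg (O : ValuationSubring K) (z : Fin n → K) (hzO : ∀ j, z j ∈ O) (hz0 : ∀ j, z j ≠ 0)
    (e : Fin n → ℤ) (he : O.valuation (∏ j, z j ^ e j) < 1) :
    ∃ (z' : Fin n → K) (T : (Fin n → ℤ) → (Fin n → ℤ)),
      ((∀ j, z' j ∈ O) ∧ (∀ j, z' j ≠ 0) ∧
        IntermediateField.adjoin k (Set.range z') = IntermediateField.adjoin k (Set.range z) ∧
        (∀ f, (∏ j, z' j ^ T f j) = ∏ j, z j ^ f j) ∧ (∀ f, T (-f) = -T f) ∧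
        (∀ f : Fin n → ℤ, (∀ j, 0 ≤ f j) → ∀ j, 0 ≤ T f j) ∧ (∀ f : Fin n → ℤ, (∃ j, Odd (f j)) → ∃ j, Odd (T f j))) ∧
      (∀ j, 0 ≤ T e j) := by
  obtain ⟨z', T, hR, hU⟩ := exists_relettering_uniform (k := k) O z hzO hz0 e
  refine ⟨z', T, hR, ?_⟩
  rcases hU with hU | hU
  · exact hU
  · -- all exponents `≤ 0`: then `(z^e)⁻¹ = z' ^ (-T e)` lies in `O`, contradicting `v(z^e) < 1`
    exfalso
    have hinv : (∏ j, z j ^ e j)⁻¹ ∈ O := by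
      rw [← hR.2.2.2.1 e, ← Finset.prod_inv_distrib]
      refine prod_mem fun j _ => ?_
      rw [← zpow_neg]
      obtain ⟨c, hc⟩ := Int.exists_eq_neg_ofNat (hU j)
      rw [hc, neg_neg, zpow_natCast]
      exact pow_mem (hR.1 j) c
    have hne : (∏ j, z j ^ e j) ≠ 0 := Finset.prod_ne_zero_iff.mpr fun j _ => zpow_ne_zero _ (hz0 j)
    have h1 : O.valuation ((∏ j, z j ^ e j)⁻¹) ≤ 1 := (O.valuation_le_one_iff _).mpr hinv
    rw [map_inv₀, inv_le_one₀ (zero_lt_iff.mpr ((map_ne_zero _).mpr hne))] at h1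
    exact absurd he (not_lt.mpr h1)

/-- **Perron monomialisation of finitely many Laurent monomials of positive value at once.** OURS. [folklore] -/
theorem exists_relettering_nonneg_family (O : ValuationSubring K) :
    ∀ (m : ℕ) (z : Fin n → K) (_ : ∀ j, z j ∈ O) (_ : ∀ j, z j ≠ 0) (F : Fin m → Fin n → ℤ)
      (_ : ∀ i, O.valuation (∏ j, z j ^ F i j) < 1),
      ∃ (z' : Fin n → K) (T : (Fin n → ℤ) → (Fin n → ℤ)),
        ((∀ j, z' j ∈ O) ∧ (∀ j, z' j ≠ 0) ∧
          IntermediateField.adjoin k (Set.range z') = IntermediateField.adjoin k (Set.range z) ∧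
          (∀ f, (∏ j, z' j ^ T f j) = ∏ j, z j ^ f j) ∧ (∀ f, T (-f) = -T f) ∧
          (∀ f : Fin n → ℤ, (∀ j, 0 ≤ f j) → ∀ j, 0 ≤ T f j) ∧ (∀ f : Fin n → ℤ, (∃ j, Odd (f j)) → ∃ j, Odd (T f j))) ∧
        ∀ i j, 0 ≤ T (F i) j := by
  intro m
  induction m with
  | zero =>
    intro z hzO hz0 F _
    exact ⟨z, id, relettering_refl O z hzO hz0, fun i => i.elim0⟩
  | succ m ih =>
    intro z hzO hz0 F hF
    -- first monomialise `F 0`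
    obtain ⟨z₁, T₁, hR₁, h0⟩ := exists_relettering_nonneg (k := k) O z hzO hz0 (F 0) (hF 0)
    -- the remaining targets, re-expressed in `z₁`
    have hF' : ∀ i : Fin m, O.valuation (∏ j, z₁ j ^ T₁ (F i.succ) j) < 1 := fun i => by
      rw [hR₁.2.2.2.1]; exact hF i.succ
    obtain ⟨z₂, T₂, hR₂, hrest⟩ := ih z₁ hR₁.1 hR₁.2.1 (fun i => T₁ (F i.succ)) hF'
    refine ⟨z₂, T₂ ∘ T₁, relettering_trans O hR₁ hR₂, fun i => ?_⟩
    refine Fin.cases ?_ (fun i => ?_) i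
    · exact hR₂.2.2.2.2.2.1 _ h0
    · exact hrest i

end Perron

end Summit.ResolutionOfSingularities.ResolutionOfSingularities.Theorems.SteerToricVertexSplit

end
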